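import Summits.CriticalPhenomena.SAWScalingLimit.Theorems.SAWDefectDecoherenceBoundaryWindingRigidity
import Summits.CriticalPhenomena.SAWScalingLimit.Theorems.SAWDefectDecoherenceSpinShift
import HarnessLib

/-!
# Boundary exactness of the SAW developing map, II: the boundary phase law (E2)

Route `SAWDefectDecoherence`, crux `BoundaryClosureR` (stmt-CriticalPhenomena-14004), line
`pick-half-plane`, clause (E2) of the stub `stub_boundaryExactness`: for a simply connected `Λ`,
a boundary root `a = {u, w}` and a boundary mid-edge `e = {u', w'} ≠ a`,
`(mid e - c_{w'}) · F_{x_c,5/8}(e) = ((c_w - c_u)/2) · e^{i(3/8)W(γ)} · |F_{x_c,0}(e)|` for any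
walk `γ : a → e`.  Ingredients: rigidity of the winding between boundary mid-edges
(`boundaryWindingRigidity_proof`, the tree's discrete Umlaufsatz), so that
`F_{5/8}(e) = e^{-i(5/8)W(γ)} F_0(e)` with `F_0(e) = Σ x_c^ℓ ≥ 0`; and the telescoping of the unit
tangent along the walk (`SpinShift.exp_winding_mul_I_mul_unit`), which turns the first half-edge
`(c_w - c_u)/2` into the last one `mid e - c_{w'} = (c_{u'} - c_{w'})/2` by the factor `e^{iW(γ)}`.
-/

noncomputable section

open Literature.Probability.LatticeModels Literature.Probability.RandomPlanarGeometry.SAW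
open Summit.CriticalPhenomena.SAWScalingLimit.Theorems.SpinShift
  (exp_winding_mul_I_mul_unit hexCenter_sub_ne_zero_of_adj norm_hexCenter_sub_eq_of_adj)

namespace Summit.CriticalPhenomena.SAWScalingLimit.Theorems.PickHalfPlane.BoundaryExactness

variable {Λ : Finset HexVertex}

/-- A dangling edge `{u, w}` (`u ∼ w`, `u ∉ Λ ∋ w`) is a boundary mid-edge. [folklore] -/
theorem mk_mem_hexDomainBoundary {u w : HexVertex} (huw : hexGraph.Adj u w) (hu : u ∉ Λ)
    (hw : w ∈ Λ) : s(u, w) ∈ hexDomainBoundary Λ :=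
  ⟨(SimpleGraph.mem_edgeSet hexGraph).2 huw, u, w, rfl, hw, hu⟩

/-! ### (E2) The boundary phase law -/

/-- **The unit tangent of a walk between two boundary mid-edges turns by `e^{iW}` from the first
half-edge to the last**: for a walk `γ` from the root `{u, w}` (`u ∉ Λ`) to the boundary mid-edge
`{u', w'}` (`u' ∉ Λ`, different from the root), `e^{iW(γ)} (c_w - c_u) = c_{u'} - c_{w'}` — the
walk enters at `w` heading `c_w - c_u` and leaves through `w'` heading `c_{u'} - c_{w'}`, all edges
have the same length, and the turning angles telescope (`exp_winding_mul_I_mul_unit`).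
[folklore] -/
theorem exp_winding_mul_dir {u w u' w' : HexVertex} (huw : hexGraph.Adj u w) (hu : u ∉ Λ)
    (huw' : hexGraph.Adj u' w') (hu' : u' ∉ Λ) (hne : s(u', w') ≠ s(u, w))
    (γ : HexMidEdgeSAW Λ s(u, w) s(u', w')) :
    Complex.exp ((γ.winding : ℂ) * Complex.I) * (hexCenter w - hexCenter u) =
      hexCenter u' - hexCenter w' := by
  have hnil : γ.verts ≠ [] := fun h => hne (γ.eq_of_nil h).symm
  obtain ⟨w₁, rest, hrest⟩ := List.exists_cons_of_ne_nil hnil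
  have hw₁ : w₁ = w := by
    have := γ.head_eq rfl hu hnil; simpa [hrest] using this
  subst hw₁
  obtain ⟨init, g, hinit⟩ : ∃ init g, γ.verts = init ++ [g] :=
    ⟨_, _, (List.dropLast_append_getLast hnil).symm⟩
  have hg : g = w' := by
    have h1 : γ.verts.getLast hnil = g := by simp [hinit]
    rcases γ.getLast_eq_or hnil with h | h
    · exact absurd (h ▸ γ.subset _ (List.getLast_mem hnil)) hu'
    · rw [← h1, h]
  subst hg
  set D₁ : ℂ := hexCenter w₁ - hexCenter u with hD₁
  set D₂ : ℂ := hexCenter g - hexCenter u' with hD₂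
  have hD₁0 : D₁ ≠ 0 := hexCenter_sub_ne_zero_of_adj huw
  have hD₂0 : D₂ ≠ 0 := hexCenter_sub_ne_zero_of_adj huw'
  have hnorm : ‖D₁‖ = ‖D₂‖ := norm_hexCenter_sub_eq_of_adj huw huw'
  have e₁ : hexCenter w₁ - hexMidpoint s(u, w₁) = D₁ / 2 := by rw [hexMidpoint_mk, hD₁]; ring
  have e₂ : hexMidpoint s(u', g) - hexCenter g = -(D₂ / 2) := by rw [hexMidpoint_mk, hD₂]; ring
  -- the polyline, written from both ends
  have hp1 : γ.points = hexMidpoint s(u, w₁) :: hexCenter w₁ ::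
      (rest.map hexCenter ++ [hexMidpoint s(u', g)]) := by
    simp [HexMidEdgeSAW.points, hrest]
  have hp2 : (hexMidpoint s(u, w₁) :: init.map hexCenter) ++ [hexCenter g, hexMidpoint s(u', g)] =
      γ.points := by
    simp [HexMidEdgeSAW.points, hinit, List.map_append, List.append_assoc]
  -- consecutive points are distinct
  have hch0 : List.IsChain (· ≠ ·) (γ.verts.map hexCenter) :=
    List.isChain_map_of_isChain hexCenter
      (fun a b hab => (sub_ne_zero.1 (hexCenter_sub_ne_zero_of_adj hab)).symm) γ.isChain
  have hch1 : List.IsChain (· ≠ ·) (hexMidpoint s(u, w₁) :: γ.verts.map hexCenter) := by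
    rw [hrest, List.map_cons, List.isChain_cons_cons]
    refine ⟨?_, by rw [← List.map_cons, ← hrest]; exact hch0⟩
    intro h
    apply hD₁0
    have h' : hexCenter w₁ - hexMidpoint s(u, w₁) = 0 := by rw [h, sub_self]
    rw [e₁] at h'
    simpa using h'
  have hch : List.IsChain (· ≠ ·)
      ((hexMidpoint s(u, w₁) :: init.map hexCenter) ++ [hexCenter g, hexMidpoint s(u', g)]) := by
    rw [List.isChain_append_cons_cons]
    refine ⟨?_, ?_, List.isChain_singleton _⟩
    · have e : (hexMidpoint s(u, w₁) :: init.map hexCenter) ++ [hexCenter g] =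
          hexMidpoint s(u, w₁) :: γ.verts.map hexCenter := by
        rw [hinit, List.map_append, List.map_cons, List.map_nil, List.cons_append]
      rw [e]
      exact hch1
    · intro h
      apply hD₂0
      have h' : hexMidpoint s(u', g) - hexCenter g = 0 := by rw [h, sub_self]
      rw [e₂] at h'
      simpa using h'
  -- telescope
  have key := exp_winding_mul_I_mul_unit (rest.map hexCenter ++ [hexMidpoint s(u', g)])
    (hexMidpoint s(u, w₁)) (hexCenter w₁) (hexMidpoint s(u, w₁) :: init.map hexCenter)
    (hexCenter g) (hexMidpoint s(u', g)) (hp2.trans hp1) (by rw [← hp1, ← hp2]; exact hch)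
  rw [← hp1] at key
  change Complex.exp ((γ.winding : ℂ) * Complex.I) * _ = _ at key
  rw [e₁, e₂, norm_neg, norm_div, norm_div, hnorm] at key
  have hn0 : (‖D₂‖ : ℂ) ≠ 0 := by exact_mod_cast norm_ne_zero_iff.2 hD₂0
  simp only [RCLike.norm_ofNat, Complex.ofReal_div, Complex.ofReal_ofNat] at key
  field_simp at key
  rw [hD₂] at key
  linear_combination key

/-- **(E2) The boundary phase law.** For a simply connected `Λ`, a boundary root `a = {u, w}`
(`u ∼ w`, `u ∉ Λ ∋ w`), a boundary mid-edge `e = {u', w'} ≠ a` (`u' ∉ Λ ∋ w'`) and any walk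
`γ : a → e`: `(mid e - c_{w'}) · F_{x_c, 5/8}(e) = ((c_w - c_u)/2) · e^{i(3/8)W(γ)} · |F_{x_c, 0}(e)|`.
All walks `a → e` have winding `W(γ)` (rigidity), so `F_{5/8}(e) = e^{-i(5/8)W(γ)} F_0(e)` with
`F_0(e) = Σ x_c^ℓ ≥ 0`, and `mid e - c_{w'} = (c_{u'} - c_{w'})/2 = e^{iW(γ)} (c_w - c_u)/2`
(`exp_winding_mul_dir`). [folklore] -/
theorem boundaryPhaseLaw (Λ : Finset HexVertex) (hΛ : hexDomainSimplyConnected Λ)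
    (u w : HexVertex) (huw : hexGraph.Adj u w) (hu : u ∉ Λ) (hw : w ∈ Λ)
    (u' w' : HexVertex) (huw' : hexGraph.Adj u' w') (hu' : u' ∉ Λ) (hw' : w' ∈ Λ)
    (hne : s(u', w') ≠ s(u, w)) (γ : HexMidEdgeSAW Λ s(u, w) s(u', w')) :
    (hexMidpoint s(u', w') - hexCenter w') *
        hexParafermionicObservable Λ s(u, w) hexCriticalFugacity (5 / 8) s(u', w') =
      (hexCenter w - hexCenter u) / 2 * Complex.exp (Complex.I * (3 / 8 : ℂ) * (γ.winding : ℂ)) *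
        (‖hexParafermionicObservable Λ s(u, w) hexCriticalFugacity 0 s(u', w')‖ : ℂ) := by
  have hW : ∀ γ' : HexMidEdgeSAW Λ s(u, w) s(u', w'), γ'.winding = γ.winding := fun γ' =>
    boundaryWindingRigidity_proof Λ hΛ _ (mk_mem_hexDomainBoundary huw hu hw) _
      (mk_mem_hexDomainBoundary huw' hu' hw') γ' γ
  set F0 := hexParafermionicObservable Λ s(u, w) hexCriticalFugacity 0 s(u', w') with hF0
  have hnorm : (‖F0‖ : ℂ) = F0 := by
    rw [hF0, hexParafermionicObservable_zero_spin, Complex.norm_real, Real.norm_of_nonneg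
      (Finset.sum_nonneg fun γ' _ => pow_nonneg hexCriticalFugacity_pos_lt_one.1.le _)]
  have hFσ : hexParafermionicObservable Λ s(u, w) hexCriticalFugacity (5 / 8) s(u', w') =
      Complex.exp (-Complex.I * ((5 / 8 : ℝ) : ℂ) * (γ.winding : ℂ)) * F0 := by
    rw [hF0, hexParafermionicObservable, hexParafermionicObservable, Finset.mul_sum]
    refine Finset.sum_congr rfl fun γ' _ => ?_
    rw [HexMidEdgeSAW.weight, HexMidEdgeSAW.weight_zero_spin, hW γ']
  have hdir : hexMidpoint s(u', w') - hexCenter w' =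
      Complex.exp ((γ.winding : ℂ) * Complex.I) * ((hexCenter w - hexCenter u) / 2) := by
    rw [← mul_div_assoc, exp_winding_mul_dir huw hu huw' hu' hne γ, hexMidpoint_mk]
    ring
  have hexp : Complex.exp ((γ.winding : ℂ) * Complex.I) *
      Complex.exp (-Complex.I * ((5 / 8 : ℝ) : ℂ) * (γ.winding : ℂ)) =
      Complex.exp (Complex.I * (3 / 8 : ℂ) * (γ.winding : ℂ)) := by
    rw [← Complex.exp_add]
    congr 1
    push_cast
    ring
  rw [hFσ, hdir, hnorm, ← hexp]
  ring

/-- **Clause (E2) of the registered stub `stub_boundaryExactness`**, in closed form. [folklore] -/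
theorem boundaryExactness_phaseLaw :
    ∀ (Λ : Finset HexVertex), hexDomainSimplyConnected Λ →
      ∀ (u w : HexVertex), hexGraph.Adj u w → u ∉ Λ → w ∈ Λ →
      ∀ (u' w' : HexVertex), hexGraph.Adj u' w' → u' ∉ Λ → w' ∈ Λ → s(u', w') ≠ s(u, w) →
      ∀ γ : HexMidEdgeSAW Λ s(u, w) s(u', w'),
        (hexMidpoint s(u', w') - hexCenter w') *
            hexParafermionicObservable Λ s(u, w) hexCriticalFugacity (5 / 8) s(u', w') =
          (hexCenter w - hexCenter u) / 2 *
              Complex.exp (Complex.I * (3 / 8 : ℂ) * (γ.winding : ℂ)) *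
            (‖hexParafermionicObservable Λ s(u, w) hexCriticalFugacity 0 s(u', w')‖ : ℂ) :=
  boundaryPhaseLaw

end Summit.CriticalPhenomena.SAWScalingLimit.Theorems.PickHalfPlane.BoundaryExactness
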